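import Literature.NumberTheory.EllipticCurves.FormalGroupLawChordFormulaProofs
import Literature.NumberTheory.EllipticCurves.FormalGroupChartUniquenessProofs
import Literature.NumberTheory.EllipticCurves.FormalGroupLawAxiomsUniversalProofs
import Mathlib.RingTheory.LaurentSeries
import HarnessLib

/-!
# Formal points over Laurent-series fields: the formal group law computes `E(k⸨X⸩)`
# (Silverman AEC IV.1, VII.2.2 over `k⸨X⸩`)

Trunk T-NT-EC (Literature/NumberTheory/EllipticCurves). For a Weierstrass curve `E` over a field
`k` and a parameter `σ ∈ X·k⟦X⟧`, the **formal point** `P(σ) = (x(σ), y(σ)) = (X(σ)/σ², −X(σ)/σ³)`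
(`X = formalXMulSq`, AEC IV.1.1) is a `k⸨X⸩`-rational affine point of `E` (`laurentPt`; `P(0) = O`).
Main results (all for the reduction `E = V ⊗ k` of a Weierstrass curve `V` over `ℤ_p` with
elliptic generic fibre, `char k ≠ 2` where stated):

* `laurentPt_injective`, `neg_laurentPt` (`−P(σ) = P(i(σ))`);
* `laurentPt_formalGroupLaw` — **`P(F(σ, τ)) = P(σ) + P(τ)`**; `laurentPt_formalMul` —
  **`P([n](σ)) = n • P(σ)`**.

The proof transports the `ℤ_p`-power-series identities of `FormalGroupLawChordFormulaProofs`
(the formal group law computes the chord and the tangent, poles cleared) along `ℤ_p → k`, reads them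
through `σ, τ`, and divides in the field `k⸨X⸩` (`chart_chordX/Y`, `chart_doubleX/Y`); the case split
`x(σ) = x(τ)` is settled by injectivity (`P(τ) = ±P(σ) ⇒ τ = σ` or `τ = i(σ)`, `F(σ, i(σ)) = 0`).
Used by `FormalGroupFrobeniusTypeProofs` (Honda's congruences for `log_E`, via `π² − aπ + p = 0` on the
formal point over `𝔽_p⸨X⸩`). Definitions `laurentX`, `laurentY`, `laurentPt`; no named facts.

## References

* J. H. Silverman, *The Arithmetic of Elliptic Curves*, GTM 106, 2nd ed. (2009), IV.1–IV.2,
  III.2.3, VII.2.2. [cite: SilvermanAEC2009]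
* T. Honda, *On the theory of commutative formal groups*, J. Math. Soc. Japan 22 (1970), §6.2. [Honda1970]
-/

noncomputable section

open scoped Classical

/-! ## Formal points over Laurent-series fields -/

namespace WeierstrassCurve

open scoped LaurentSeries
open PowerSeries Literature.NumberTheory.EllipticCurves

section LaurentPoints

variable {k : Type*} [Field k] (E : WeierstrassCurve k)

/-- **The `x`-coordinate `x(σ) = X(σ)/σ²` of the formal point with parameter `σ ∈ Xk⟦X⟧`**, an
element of the Laurent-series field `k⸨X⸩` (`X = formalXMulSq = z²x(z)`, Silverman AEC IV.1:
`x(z) = z/w(z) = z⁻² − a₁z⁻¹ − ⋯`). [cite: SilvermanAEC2009, IV.1.1] -/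
def laurentX (σ : k⟦X⟧) : k⸨X⸩ :=
  ((E.formalXMulSq.subst σ : k⟦X⟧) : k⸨X⸩) / ((σ : k⟦X⟧) : k⸨X⸩) ^ 2

/-- **The `y`-coordinate `y(σ) = −X(σ)/σ³`** (`y(z) = −1/w(z) = −z⁻³ + ⋯`).
[cite: SilvermanAEC2009, IV.1.1] -/
def laurentY (σ : k⟦X⟧) : k⸨X⸩ :=
  -((E.formalXMulSq.subst σ : k⟦X⟧) : k⸨X⸩) / ((σ : k⟦X⟧) : k⸨X⸩) ^ 3

variable {E}

omit [Field k] in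
/-- A nonzero power series is a nonzero Laurent series. [folklore] -/
theorem coe_laurent_ne_zero {k : Type*} [CommRing k] {σ : k⟦X⟧} (hσ : σ ≠ 0) :
    ((σ : k⟦X⟧) : k⸨X⸩) ≠ 0 := fun h =>
  hσ (HahnSeries.ofPowerSeries_injective (by rw [h]; exact (PowerSeries.coe_zero).symm))

/-- `X(σ)` has constant term `1`, so it is nonzero. [folklore] -/
theorem constantCoeff_formalXMulSq_subst {σ : k⟦X⟧} (h0 : constantCoeff σ = 0) :
    constantCoeff (E.formalXMulSq.subst σ) = 1 := by
  rw [Literature.RingTheory.FormalGroups.constantCoeff_subst_of_constantCoeff_eq_zero h0,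
    E.constantCoeff_formalXMulSq]

/-- `X(σ) ≠ 0`. [folklore] -/
theorem formalXMulSq_subst_ne_zero {σ : k⟦X⟧} (h0 : constantCoeff σ = 0) :
    E.formalXMulSq.subst σ ≠ 0 := fun h => by
  have := constantCoeff_formalXMulSq_subst (E := E) h0
  rw [h, map_zero] at this
  exact zero_ne_one this

/-- The coefficients of the base change to `k⸨X⸩` are the constants `aᵢ`. [folklore] -/
theorem algebraMap_laurentSeries_eq_coe_C (a : k) : algebraMap k k⸨X⸩ a = ((C a : k⟦X⟧) : k⸨X⸩) := rfl

/-- **The formal point lies on the curve**: `(x(σ), y(σ)) ∈ E(k⸨X⸩)` — the Weierstrass equation in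
the `z`-chart `X² = X³ + a₁zX² + a₂z²X² + a₃z³X + a₄z⁴X + a₆z⁶` (`formalXMulSq_subst_sq_eq`) divided
by `σ⁶`. [Silverman AEC IV.1 ("formally `(x(z), y(z))` is a point of `E`")]
[cite: SilvermanAEC2009, IV.1.1] -/
theorem laurent_equation {σ : k⟦X⟧} (h0 : constantCoeff σ = 0) (hσ : σ ≠ 0) :
    (E.baseChange k⸨X⸩).toAffine.Equation (E.laurentX σ) (E.laurentY σ) := by
  have hid := E.formalXMulSq_subst_sq_eq h0
  have hid' := congrArg (fun f : k⟦X⟧ => (f : k⸨X⸩)) hid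
  simp only [PowerSeries.coe_add, PowerSeries.coe_mul, PowerSeries.coe_pow] at hid'
  have hs := coe_laurent_ne_zero hσ
  have hs6 : ((σ : k⟦X⟧) : k⸨X⸩) ^ 6 ≠ 0 := pow_ne_zero 6 hs
  rw [Affine.equation_iff]
  simp only [baseChange, map_a₁, map_a₂, map_a₃, map_a₄, map_a₆, algebraMap_laurentSeries_eq_coe_C, laurentX,
    laurentY]
  set A : k⸨X⸩ := ((E.formalXMulSq.subst σ : k⟦X⟧) : k⸨X⸩) with hA
  set s : k⸨X⸩ := ((σ : k⟦X⟧) : k⸨X⸩) with hsdef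
  have e1 : (-A / s ^ 3) ^ 2 + ((C E.a₁ : k⟦X⟧) : k⸨X⸩) * (A / s ^ 2) * (-A / s ^ 3) +
      ((C E.a₃ : k⟦X⟧) : k⸨X⸩) * (-A / s ^ 3) =
      (A ^ 2 - ((C E.a₁ : k⟦X⟧) : k⸨X⸩) * s * A ^ 2 - ((C E.a₃ : k⟦X⟧) : k⸨X⸩) * s ^ 3 * A) / s ^ 6 := by
    field_simp
    ring
  have e2 : (A / s ^ 2) ^ 3 + ((C E.a₂ : k⟦X⟧) : k⸨X⸩) * (A / s ^ 2) ^ 2 +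
      ((C E.a₄ : k⟦X⟧) : k⸨X⸩) * (A / s ^ 2) + ((C E.a₆ : k⟦X⟧) : k⸨X⸩) =
      (A ^ 3 + ((C E.a₂ : k⟦X⟧) : k⸨X⸩) * s ^ 2 * A ^ 2 + ((C E.a₄ : k⟦X⟧) : k⸨X⸩) * s ^ 4 * A +
        ((C E.a₆ : k⟦X⟧) : k⸨X⸩) * s ^ 6) / s ^ 6 := by
    field_simp
  rw [e1, e2, div_left_inj' hs6]
  linear_combination hid'

/-- The formal point is nonsingular (for an elliptic curve). [folklore] -/
theorem laurent_nonsingular [E.IsElliptic] {σ : k⟦X⟧} (h0 : constantCoeff σ = 0) (hσ : σ ≠ 0) :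
    (E.baseChange k⸨X⸩).toAffine.Nonsingular (E.laurentX σ) (E.laurentY σ) :=
  (Affine.equation_iff_nonsingular (W := E.baseChange k⸨X⸩)).mp (laurent_equation h0 hσ)

variable (E) in
/-- **The formal point `P(σ) = (x(σ), y(σ)) ∈ E(k⸨X⸩)` with parameter `σ ∈ Xk⟦X⟧`**, with
`P(0) = O` (Silverman AEC IV.1–IV.2, VII.2.2: the map `z ↦ (x(z), y(z))` from the formal group to
the kernel of reduction). [cite: SilvermanAEC2009, IV.1.1] -/
def laurentPt [E.IsElliptic] (σ : k⟦X⟧) (h0 : constantCoeff σ = 0) :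
    (E.baseChange k⸨X⸩).toAffine.Point :=
  if hσ : σ = 0 then 0 else .some _ _ (laurent_nonsingular h0 hσ)

variable [E.IsElliptic]

/-- `P(0) = O`. [folklore] -/
@[simp] theorem laurentPt_zero (h0 : constantCoeff (0 : k⟦X⟧) = 0) : E.laurentPt 0 h0 = 0 := by
  rw [laurentPt, dif_pos rfl]

/-- `P(σ) = (x(σ), y(σ))` for `σ ≠ 0`. [folklore] -/
theorem laurentPt_of_ne_zero {σ : k⟦X⟧} (h0 : constantCoeff σ = 0) (hσ : σ ≠ 0) :
    E.laurentPt σ h0 = .some _ _ (laurent_nonsingular h0 hσ) := by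
  rw [laurentPt, dif_neg hσ]

/-- `P(σ) ≠ O` for `σ ≠ 0`. [folklore] -/
theorem laurentPt_ne_zero {σ : k⟦X⟧} (h0 : constantCoeff σ = 0) (hσ : σ ≠ 0) :
    E.laurentPt σ h0 ≠ 0 := by
  rw [laurentPt_of_ne_zero h0 hσ]; exact Affine.Point.some_ne_zero _

omit [E.IsElliptic] in
/-- **The parameter is recovered as `z = −x/y`**: `−x(σ)/y(σ) = σ`. [Silverman AEC IV.1
("the map … has inverse `(x, y) ↦ −x/y`")] [cite: SilvermanAEC2009, IV.1.1] -/
theorem neg_laurentX_div_laurentY {σ : k⟦X⟧} (h0 : constantCoeff σ = 0) (hσ : σ ≠ 0) :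
    -E.laurentX σ / E.laurentY σ = ((σ : k⟦X⟧) : k⸨X⸩) := by
  have hs := coe_laurent_ne_zero hσ
  have hX := coe_laurent_ne_zero (formalXMulSq_subst_ne_zero (E := E) h0)
  rw [laurentX, laurentY]
  field_simp

/-- **`σ ↦ P(σ)` is injective.** [folklore] -/
theorem laurentPt_injective {σ τ : k⟦X⟧} (hσ0 : constantCoeff σ = 0) (hτ0 : constantCoeff τ = 0)
    (h : E.laurentPt σ hσ0 = E.laurentPt τ hτ0) : σ = τ := by
  by_cases hσ : σ = 0
  · subst hσ
    by_contra hτ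
    rw [laurentPt_zero] at h
    exact laurentPt_ne_zero hτ0 (Ne.symm hτ) h.symm
  by_cases hτ : τ = 0
  · subst hτ
    rw [laurentPt_zero] at h
    exact absurd h (laurentPt_ne_zero hσ0 hσ)
  rw [laurentPt_of_ne_zero hσ0 hσ, laurentPt_of_ne_zero hτ0 hτ, Affine.Point.some.injEq] at h
  apply HahnSeries.ofPowerSeries_injective (Γ := ℤ) (R := k)
  change ((σ : k⟦X⟧) : k⸨X⸩) = ((τ : k⟦X⟧) : k⸨X⸩)
  rw [← neg_laurentX_div_laurentY hσ0 hσ, ← neg_laurentX_div_laurentY hτ0 hτ, h.1, h.2]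

omit [E.IsElliptic] in
/-- `i(σ)` has no constant term. [folklore] -/
theorem constantCoeff_formalNeg_subst {σ : k⟦X⟧} (h0 : constantCoeff σ = 0) :
    constantCoeff (E.formalNeg.subst σ) = 0 := by
  rw [Literature.RingTheory.FormalGroups.constantCoeff_subst_of_constantCoeff_eq_zero h0,
    E.constantCoeff_formalNeg]

omit [E.IsElliptic] in
/-- `i(σ) ≠ 0` for `σ ≠ 0` (`i(i(σ)) = σ`). [folklore] -/
theorem formalNeg_subst_ne_zero {σ : k⟦X⟧} (h0 : constantCoeff σ = 0) (hσ : σ ≠ 0) :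
    E.formalNeg.subst σ ≠ 0 := fun h => by
  have hs : HasSubst σ := HasSubst.of_constantCoeff_zero' h0
  have h2 := congrArg (PowerSeries.subst σ) E.formalNeg_subst_formalNeg_eq_X
  rw [subst_comp_subst_apply E.hasSubst_formalNeg hs, h, subst_X hs,
    subst_zero_of_constantCoeff_zero E.constantCoeff_formalNeg] at h2
  exact hσ h2.symm

omit [E.IsElliptic] in
/-- Field algebra of `x(−P) = x(P)` in the chart. [folklore] -/
theorem neg_aux_x {K : Type*} [Field K] {A AI I s : K} (hs : s ≠ 0) (hI : I ≠ 0)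
    (h1 : AI * s ^ 2 = A * I ^ 2) : A / s ^ 2 = AI / I ^ 2 := by
  rw [div_eq_div_iff (pow_ne_zero 2 hs) (pow_ne_zero 2 hI)]
  linear_combination -h1

omit [E.IsElliptic] in
/-- Field algebra of `y(−P) = −y − a₁x − a₃` in the chart. [folklore] -/
theorem neg_aux_y {K : Type*} [Field K] {A AI I s a₁ a₃ : K} (hs : s ≠ 0) (hI : I ≠ 0)
    (h1 : AI * s ^ 2 = A * I ^ 2) (h2 : A * (I + s - a₁ * s * I) = a₃ * s ^ 3 * I) :
    -(-A / s ^ 3) - a₁ * (A / s ^ 2) - a₃ = -AI / I ^ 3 := by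
  have hAI : AI = A * I ^ 2 / s ^ 2 := by rw [eq_div_iff (pow_ne_zero 2 hs)]; exact h1
  have e3 : -AI / I ^ 3 = -A / (s ^ 2 * I) := by rw [hAI]; field_simp
  have e4 : -(-A / s ^ 3) - a₁ * (A / s ^ 2) - a₃ = (A - a₁ * A * s - a₃ * s ^ 3) / s ^ 3 := by
    field_simp
  rw [e3, e4, div_eq_div_iff (pow_ne_zero 3 hs) (mul_ne_zero (pow_ne_zero 2 hs) hI)]
  linear_combination s ^ 2 * h2

/-- **Negation: `−P(σ) = P(i(σ))`** (`x(i(z)) = x(z)`, `y(i(z)) = −y − a₁x − a₃`, the tree's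
`formalXMulSq_subst_formalNeg_mul_X_sq` and `formalXMulSq_mul_formalNeg_add` read through `σ`).
[Silverman AEC III.2.3, IV.1 (p. 118)] [cite: SilvermanAEC2009, IV.1.1] -/
theorem neg_laurentPt {σ : k⟦X⟧} (h0 : constantCoeff σ = 0) :
    -E.laurentPt σ h0 = E.laurentPt (E.formalNeg.subst σ) (constantCoeff_formalNeg_subst h0) := by
  by_cases hσ : σ = 0
  · subst hσ
    have : E.formalNeg.subst (0 : k⟦X⟧) = 0 := subst_zero_of_constantCoeff_zero E.constantCoeff_formalNeg
    rw [laurentPt_zero, neg_zero, laurentPt, dif_pos this]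
  have hs : HasSubst σ := HasSubst.of_constantCoeff_zero' h0
  have hi0 := formalNeg_subst_ne_zero (E := E) h0 hσ
  rw [laurentPt_of_ne_zero h0 hσ, laurentPt_of_ne_zero _ hi0, Affine.Point.neg_some, Affine.Point.some.injEq]
  -- the two identities, read through `σ` and coerced to `k⸨X⸩`
  have h1 := E.formalXMulSq_subst_formalNeg_mul_X_sq
  apply_fun (fun f : k⟦X⟧ => ((f.subst σ : k⟦X⟧) : k⸨X⸩)) at h1
  have h2 := E.formalXMulSq_mul_formalNeg_add
  apply_fun (fun f : k⟦X⟧ => ((f.subst σ : k⟦X⟧) : k⸨X⸩)) at h2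
  simp only [subst_mul hs, subst_pow hs, subst_add hs, subst_sub hs, subst_X hs,
    Literature.NumberTheory.EllipticCurves.C_subst, PowerSeries.coe_mul, PowerSeries.coe_pow,
    PowerSeries.coe_add, PowerSeries.coe_sub] at h1 h2
  have hsc := coe_laurent_ne_zero hσ
  have hic := coe_laurent_ne_zero hi0
  simp only [laurentX, laurentY, Affine.negY, baseChange, map_a₁, map_a₃, algebraMap_laurentSeries_eq_coe_C]
  rw [← subst_comp_subst_apply E.hasSubst_formalNeg hs E.formalXMulSq]
  exact ⟨neg_aux_x hsc hic h1, neg_aux_y hsc hic h1 h2⟩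

end LaurentPoints

end WeierstrassCurve

/-! ## The formal group law computes the addition of formal points over Laurent-series fields -/

namespace WeierstrassCurve

open scoped LaurentSeries
open PowerSeries Literature.NumberTheory.EllipticCurves

/-! ### Field algebra: from the cleared formal identities to the affine addition formulas -/

section ChartAlgebra

variable {K : Type*} [Field K]

/-- Chart transfer for `x(P + Q)`: the chord identity of `formalXMulSq_formalGroupLaw_chord`, read at
`x₁ = X₀/s²`, `x₂ = X₁/t²`, `y₁ = −X₀/s³`, `y₂ = −X₁/t³`, `x₃ = X_F/F²`. [folklore] -/
theorem chart_chordX {X₀ X₁ XF s t F a₁ a₂ : K} (hs : s ≠ 0) (ht : t ≠ 0) (hF : F ≠ 0)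
    (key : XF * (X₀ * t ^ 2 - X₁ * s ^ 2) ^ 2 * s ^ 2 * t ^ 2 =
      F ^ 2 * ((X₁ * s ^ 3 - X₀ * t ^ 3) ^ 2 + a₁ * (X₁ * s ^ 3 - X₀ * t ^ 3) * (X₀ * t ^ 2 - X₁ * s ^ 2) * s * t -
        (a₂ * s ^ 2 * t ^ 2 + X₀ * t ^ 2 + X₁ * s ^ 2) * (X₀ * t ^ 2 - X₁ * s ^ 2) ^ 2)) :
    XF / F ^ 2 * (X₀ / s ^ 2 - X₁ / t ^ 2) ^ 2 =
      (-X₀ / s ^ 3 - -X₁ / t ^ 3) ^ 2 + a₁ * (-X₀ / s ^ 3 - -X₁ / t ^ 3) * (X₀ / s ^ 2 - X₁ / t ^ 2) -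
        (a₂ + X₀ / s ^ 2 + X₁ / t ^ 2) * (X₀ / s ^ 2 - X₁ / t ^ 2) ^ 2 := by
  have hden : F ^ 2 * s ^ 6 * t ^ 6 ≠ 0 := by positivity
  rw [← mul_left_inj' hden]
  have e1 : XF / F ^ 2 * (X₀ / s ^ 2 - X₁ / t ^ 2) ^ 2 * (F ^ 2 * s ^ 6 * t ^ 6) =
      XF * (X₀ * t ^ 2 - X₁ * s ^ 2) ^ 2 * s ^ 2 * t ^ 2 := by
    field_simp
  have e2 : ((-X₀ / s ^ 3 - -X₁ / t ^ 3) ^ 2 + a₁ * (-X₀ / s ^ 3 - -X₁ / t ^ 3) * (X₀ / s ^ 2 - X₁ / t ^ 2) -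
        (a₂ + X₀ / s ^ 2 + X₁ / t ^ 2) * (X₀ / s ^ 2 - X₁ / t ^ 2) ^ 2) * (F ^ 2 * s ^ 6 * t ^ 6) =
      F ^ 2 * ((X₁ * s ^ 3 - X₀ * t ^ 3) ^ 2 + a₁ * (X₁ * s ^ 3 - X₀ * t ^ 3) * (X₀ * t ^ 2 - X₁ * s ^ 2) * s * t -
        (a₂ * s ^ 2 * t ^ 2 + X₀ * t ^ 2 + X₁ * s ^ 2) * (X₀ * t ^ 2 - X₁ * s ^ 2) ^ 2) := by
    field_simp
    ring
  rw [e1, e2, key]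

/-- Chart transfer for `y(P + Q)`. [folklore] -/
theorem chart_chordY {X₀ X₁ XF s t F a₁ a₃ : K} (hs : s ≠ 0) (ht : t ≠ 0) (hF : F ≠ 0)
    (key : (-XF + a₁ * XF * F + a₃ * F ^ 3) * (X₀ * t ^ 2 - X₁ * s ^ 2) * s ^ 3 * t =
      -((X₁ * s ^ 3 - X₀ * t ^ 3) * (XF * s ^ 2 - X₀ * F ^ 2) * F) + X₀ * (X₀ * t ^ 2 - X₁ * s ^ 2) * F ^ 3 * t) :
    (-XF / F ^ 3 + a₁ * (XF / F ^ 2) + a₃) * (X₀ / s ^ 2 - X₁ / t ^ 2) =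
      -(-X₀ / s ^ 3 - -X₁ / t ^ 3) * (XF / F ^ 2 - X₀ / s ^ 2) - -X₀ / s ^ 3 * (X₀ / s ^ 2 - X₁ / t ^ 2) := by
  have hden : F ^ 3 * s ^ 5 * t ^ 3 ≠ 0 := by positivity
  rw [← mul_left_inj' hden]
  have e1 : (-XF / F ^ 3 + a₁ * (XF / F ^ 2) + a₃) * (X₀ / s ^ 2 - X₁ / t ^ 2) * (F ^ 3 * s ^ 5 * t ^ 3) =
      (-XF + a₁ * XF * F + a₃ * F ^ 3) * (X₀ * t ^ 2 - X₁ * s ^ 2) * s ^ 3 * t := by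
    field_simp
  have e2 : (-(-X₀ / s ^ 3 - -X₁ / t ^ 3) * (XF / F ^ 2 - X₀ / s ^ 2) - -X₀ / s ^ 3 * (X₀ / s ^ 2 - X₁ / t ^ 2)) *
        (F ^ 3 * s ^ 5 * t ^ 3) =
      -((X₁ * s ^ 3 - X₀ * t ^ 3) * (XF * s ^ 2 - X₀ * F ^ 2) * F) + X₀ * (X₀ * t ^ 2 - X₁ * s ^ 2) * F ^ 3 * t := by
    field_simp
    ring
  rw [e1, e2, key]

/-- Chart transfer for `x(2P)`. [folklore] -/
theorem chart_doubleX {X XD s D a₁ a₂ a₃ a₄ : K} (hs : s ≠ 0) (hD : D ≠ 0)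
    (key : XD * s ^ 2 * ((a₁ * s - 2) * X + a₃ * s ^ 3) ^ 2 =
      D ^ 2 * ((3 * X ^ 2 + 2 * a₂ * s ^ 2 * X + a₄ * s ^ 4 + a₁ * s * X) ^ 2 +
        a₁ * (3 * X ^ 2 + 2 * a₂ * s ^ 2 * X + a₄ * s ^ 4 + a₁ * s * X) * s * ((a₁ * s - 2) * X + a₃ * s ^ 3) -
        a₂ * s ^ 2 * ((a₁ * s - 2) * X + a₃ * s ^ 3) ^ 2 - 2 * X * ((a₁ * s - 2) * X + a₃ * s ^ 3) ^ 2)) :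
    XD / D ^ 2 * (-X / s ^ 3 - (-(-X / s ^ 3) - a₁ * (X / s ^ 2) - a₃)) ^ 2 =
      (3 * (X / s ^ 2) ^ 2 + 2 * a₂ * (X / s ^ 2) + a₄ - a₁ * (-X / s ^ 3)) ^ 2 +
        a₁ * (3 * (X / s ^ 2) ^ 2 + 2 * a₂ * (X / s ^ 2) + a₄ - a₁ * (-X / s ^ 3)) *
          (-X / s ^ 3 - (-(-X / s ^ 3) - a₁ * (X / s ^ 2) - a₃)) -
        (a₂ + 2 * (X / s ^ 2)) * (-X / s ^ 3 - (-(-X / s ^ 3) - a₁ * (X / s ^ 2) - a₃)) ^ 2 := by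
  have hden : D ^ 2 * s ^ 8 ≠ 0 := by positivity
  rw [← mul_left_inj' hden]
  have e1 : XD / D ^ 2 * (-X / s ^ 3 - (-(-X / s ^ 3) - a₁ * (X / s ^ 2) - a₃)) ^ 2 * (D ^ 2 * s ^ 8) =
      XD * s ^ 2 * ((a₁ * s - 2) * X + a₃ * s ^ 3) ^ 2 := by
    field_simp
    ring
  have e2 : ((3 * (X / s ^ 2) ^ 2 + 2 * a₂ * (X / s ^ 2) + a₄ - a₁ * (-X / s ^ 3)) ^ 2 +
        a₁ * (3 * (X / s ^ 2) ^ 2 + 2 * a₂ * (X / s ^ 2) + a₄ - a₁ * (-X / s ^ 3)) *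
          (-X / s ^ 3 - (-(-X / s ^ 3) - a₁ * (X / s ^ 2) - a₃)) -
        (a₂ + 2 * (X / s ^ 2)) * (-X / s ^ 3 - (-(-X / s ^ 3) - a₁ * (X / s ^ 2) - a₃)) ^ 2) * (D ^ 2 * s ^ 8) =
      D ^ 2 * ((3 * X ^ 2 + 2 * a₂ * s ^ 2 * X + a₄ * s ^ 4 + a₁ * s * X) ^ 2 +
        a₁ * (3 * X ^ 2 + 2 * a₂ * s ^ 2 * X + a₄ * s ^ 4 + a₁ * s * X) * s * ((a₁ * s - 2) * X + a₃ * s ^ 3) -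
        a₂ * s ^ 2 * ((a₁ * s - 2) * X + a₃ * s ^ 3) ^ 2 - 2 * X * ((a₁ * s - 2) * X + a₃ * s ^ 3) ^ 2) := by
    field_simp
    ring
  rw [e1, e2, key]

/-- Chart transfer for `y(2P)`. [folklore] -/
theorem chart_doubleY {X XD s D a₁ a₂ a₃ a₄ : K} (hs : s ≠ 0) (hD : D ≠ 0)
    (key : (-XD + a₁ * XD * D + a₃ * D ^ 3) * s ^ 3 * ((a₁ * s - 2) * X + a₃ * s ^ 3) =
      -((3 * X ^ 2 + 2 * a₂ * s ^ 2 * X + a₄ * s ^ 4 + a₁ * s * X) * (XD * s ^ 2 - X * D ^ 2) * D) +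
        X * D ^ 3 * ((a₁ * s - 2) * X + a₃ * s ^ 3)) :
    (-XD / D ^ 3 + a₁ * (XD / D ^ 2) + a₃) * (-X / s ^ 3 - (-(-X / s ^ 3) - a₁ * (X / s ^ 2) - a₃)) =
      -(3 * (X / s ^ 2) ^ 2 + 2 * a₂ * (X / s ^ 2) + a₄ - a₁ * (-X / s ^ 3)) * (XD / D ^ 2 - X / s ^ 2) -
        -X / s ^ 3 * (-X / s ^ 3 - (-(-X / s ^ 3) - a₁ * (X / s ^ 2) - a₃)) := by
  have hden : D ^ 3 * s ^ 6 ≠ 0 := by positivity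
  rw [← mul_left_inj' hden]
  have e1 : (-XD / D ^ 3 + a₁ * (XD / D ^ 2) + a₃) * (-X / s ^ 3 - (-(-X / s ^ 3) - a₁ * (X / s ^ 2) - a₃)) *
        (D ^ 3 * s ^ 6) =
      (-XD + a₁ * XD * D + a₃ * D ^ 3) * s ^ 3 * ((a₁ * s - 2) * X + a₃ * s ^ 3) := by
    field_simp
    ring
  have e2 : (-(3 * (X / s ^ 2) ^ 2 + 2 * a₂ * (X / s ^ 2) + a₄ - a₁ * (-X / s ^ 3)) * (XD / D ^ 2 - X / s ^ 2) -
        -X / s ^ 3 * (-X / s ^ 3 - (-(-X / s ^ 3) - a₁ * (X / s ^ 2) - a₃))) * (D ^ 3 * s ^ 6) =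
      -((3 * X ^ 2 + 2 * a₂ * s ^ 2 * X + a₄ * s ^ 4 + a₁ * s * X) * (XD * s ^ 2 - X * D ^ 2) * D) +
        X * D ^ 3 * ((a₁ * s - 2) * X + a₃ * s ^ 3) := by
    field_simp
    ring
  rw [e1, e2, key]

end ChartAlgebra

/-! ### The four identities, base-changed and read through formal parameters -/

section Subst

variable {p : ℕ} [Fact p.Prime] (V : WeierstrassCurve ℤ_[p]) [hE : (V.map PadicInt.Coe.ringHom).IsElliptic]
  {k : Type*} [CommRing k] (φ : ℤ_[p] →+* k)

/-- **`x(σ +_F τ)`, parameters substituted**: the chord identity for the parameters `σ, τ ∈ Xk⟦X⟧` of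
the curve `V ⊗ k`: `X(F̃)·N²·σ²τ² = F̃²·(…)` in `k⟦X⟧`, `F̃ = F(σ, τ)`. [folklore] -/
theorem formalXMulSq_formalGroupLaw_chord_subst {σ τ : k⟦X⟧} (hσ : constantCoeff σ = 0)
    (hτ : constantCoeff τ = 0) :
    (V.map φ).formalXMulSq.subst (MvPowerSeries.subst ![σ, τ] (V.map φ).formalGroupLaw) *
        ((V.map φ).formalXMulSq.subst σ * τ ^ 2 - (V.map φ).formalXMulSq.subst τ * σ ^ 2) ^ 2 * σ ^ 2 * τ ^ 2 =
      MvPowerSeries.subst ![σ, τ] (V.map φ).formalGroupLaw ^ 2 *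
        (((V.map φ).formalXMulSq.subst τ * σ ^ 3 - (V.map φ).formalXMulSq.subst σ * τ ^ 3) ^ 2 +
            C (φ V.a₁) * ((V.map φ).formalXMulSq.subst τ * σ ^ 3 - (V.map φ).formalXMulSq.subst σ * τ ^ 3) *
              ((V.map φ).formalXMulSq.subst σ * τ ^ 2 - (V.map φ).formalXMulSq.subst τ * σ ^ 2) * σ * τ -
          (C (φ V.a₂) * σ ^ 2 * τ ^ 2 + (V.map φ).formalXMulSq.subst σ * τ ^ 2 +
              (V.map φ).formalXMulSq.subst τ * σ ^ 2) *
            ((V.map φ).formalXMulSq.subst σ * τ ^ 2 - (V.map φ).formalXMulSq.subst τ * σ ^ 2) ^ 2) := by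
  have hb : MvPowerSeries.HasSubst ![σ, τ] := hasSubst_pair hσ hτ
  have h := congrArg (fun G => MvPowerSeries.subst ![σ, τ] (MvPowerSeries.map φ G))
    V.formalXMulSq_formalGroupLaw_chord
  simp only [map_mul, map_pow, map_add, map_sub, MvPowerSeries.map_X, MvPowerSeries.map_C,
    PowerSeries.map_subst (PowerSeries.HasSubst.X _), PowerSeries.map_subst V.hasSubst_formalGroupLaw,
    map_formalXMulSq, map_formalGroupLaw, MvPowerSeries.subst_mul hb, MvPowerSeries.subst_pow hb,
    MvPowerSeries.subst_add hb, MvPowerSeries.subst_sub hb, MvPowerSeries.subst_X hb, MvPowerSeries.subst_C,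
    mvSubst_powerSeries_subst (PowerSeries.HasSubst.X _) hb,
    mvSubst_powerSeries_subst (V.map φ).hasSubst_formalGroupLaw hb, Matrix.cons_val_zero,
    Matrix.cons_val_one] at h
  exact h

/-- **`y(σ +_F τ)`, parameters substituted.** [folklore] -/
theorem formalXMulSq_formalGroupLaw_chordY_subst {σ τ : k⟦X⟧} (hσ : constantCoeff σ = 0)
    (hτ : constantCoeff τ = 0) :
    (-(V.map φ).formalXMulSq.subst (MvPowerSeries.subst ![σ, τ] (V.map φ).formalGroupLaw) +
          C (φ V.a₁) * (V.map φ).formalXMulSq.subst (MvPowerSeries.subst ![σ, τ] (V.map φ).formalGroupLaw) *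
            MvPowerSeries.subst ![σ, τ] (V.map φ).formalGroupLaw +
          C (φ V.a₃) * MvPowerSeries.subst ![σ, τ] (V.map φ).formalGroupLaw ^ 3) *
        ((V.map φ).formalXMulSq.subst σ * τ ^ 2 - (V.map φ).formalXMulSq.subst τ * σ ^ 2) * σ ^ 3 * τ =
      -(((V.map φ).formalXMulSq.subst τ * σ ^ 3 - (V.map φ).formalXMulSq.subst σ * τ ^ 3) *
          ((V.map φ).formalXMulSq.subst (MvPowerSeries.subst ![σ, τ] (V.map φ).formalGroupLaw) * σ ^ 2 -
            (V.map φ).formalXMulSq.subst σ * MvPowerSeries.subst ![σ, τ] (V.map φ).formalGroupLaw ^ 2) *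
          MvPowerSeries.subst ![σ, τ] (V.map φ).formalGroupLaw) +
        (V.map φ).formalXMulSq.subst σ *
          ((V.map φ).formalXMulSq.subst σ * τ ^ 2 - (V.map φ).formalXMulSq.subst τ * σ ^ 2) *
          MvPowerSeries.subst ![σ, τ] (V.map φ).formalGroupLaw ^ 3 * τ := by
  have hb : MvPowerSeries.HasSubst ![σ, τ] := hasSubst_pair hσ hτ
  have h := congrArg (fun G => MvPowerSeries.subst ![σ, τ] (MvPowerSeries.map φ G))
    V.formalXMulSq_formalGroupLaw_chordY
  simp only [map_mul, map_pow, map_add, map_sub, map_neg, MvPowerSeries.map_X, MvPowerSeries.map_C,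
    PowerSeries.map_subst (PowerSeries.HasSubst.X _), PowerSeries.map_subst V.hasSubst_formalGroupLaw,
    map_formalXMulSq, map_formalGroupLaw, MvPowerSeries.subst_mul hb, MvPowerSeries.subst_pow hb,
    MvPowerSeries.subst_add hb, MvPowerSeries.subst_sub hb, MvPowerSeries.subst_X hb, MvPowerSeries.subst_C,
    mvSubst_powerSeries_subst (PowerSeries.HasSubst.X _) hb,
    mvSubst_powerSeries_subst (V.map φ).hasSubst_formalGroupLaw hb, Matrix.cons_val_zero,
    Matrix.cons_val_one] at h
  have hneg : ∀ G : MvPowerSeries (Fin 2) k, MvPowerSeries.subst ![σ, τ] (-G) = -MvPowerSeries.subst ![σ, τ] G :=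
    fun G => by rw [← MvPowerSeries.coe_substAlgHom hb, map_neg]
  simp only [hneg, MvPowerSeries.subst_mul hb, MvPowerSeries.subst_pow hb,
    MvPowerSeries.subst_sub hb, MvPowerSeries.subst_X hb,
    mvSubst_powerSeries_subst (PowerSeries.HasSubst.X _) hb,
    mvSubst_powerSeries_subst (V.map φ).hasSubst_formalGroupLaw hb, Matrix.cons_val_zero,
    Matrix.cons_val_one] at h
  exact h

/-- **`x([2]σ)`, parameter substituted**: with `D = [2](σ)`, in `k⟦X⟧`. [folklore] -/
theorem formalXMulSq_formalMul_two_subst {σ : k⟦X⟧} (hσ : constantCoeff σ = 0) :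
    (V.map φ).formalXMulSq.subst (((V.map φ).formalMul 2).subst σ) * σ ^ 2 *
        ((C (φ V.a₁) * σ - 2) * (V.map φ).formalXMulSq.subst σ + C (φ V.a₃) * σ ^ 3) ^ 2 =
      ((V.map φ).formalMul 2).subst σ ^ 2 *
        ((3 * (V.map φ).formalXMulSq.subst σ ^ 2 + 2 * C (φ V.a₂) * σ ^ 2 * (V.map φ).formalXMulSq.subst σ +
              C (φ V.a₄) * σ ^ 4 + C (φ V.a₁) * σ * (V.map φ).formalXMulSq.subst σ) ^ 2 +
            C (φ V.a₁) * (3 * (V.map φ).formalXMulSq.subst σ ^ 2 +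
                2 * C (φ V.a₂) * σ ^ 2 * (V.map φ).formalXMulSq.subst σ + C (φ V.a₄) * σ ^ 4 +
              C (φ V.a₁) * σ * (V.map φ).formalXMulSq.subst σ) * σ *
              ((C (φ V.a₁) * σ - 2) * (V.map φ).formalXMulSq.subst σ + C (φ V.a₃) * σ ^ 3) -
          C (φ V.a₂) * σ ^ 2 * ((C (φ V.a₁) * σ - 2) * (V.map φ).formalXMulSq.subst σ + C (φ V.a₃) * σ ^ 3) ^ 2 -
          2 * (V.map φ).formalXMulSq.subst σ *
            ((C (φ V.a₁) * σ - 2) * (V.map φ).formalXMulSq.subst σ + C (φ V.a₃) * σ ^ 3) ^ 2) := by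
  have hs : PowerSeries.HasSubst σ := PowerSeries.HasSubst.of_constantCoeff_zero' hσ
  have hD : PowerSeries.HasSubst ((V.map φ).formalMul 2) :=
    PowerSeries.HasSubst.of_constantCoeff_zero' ((V.map φ).constantCoeff_formalMul 2)
  have hD' : PowerSeries.HasSubst (V.formalMul 2) :=
    PowerSeries.HasSubst.of_constantCoeff_zero' (V.constantCoeff_formalMul 2)
  have h := congrArg (fun G : ℤ_[p]⟦X⟧ => (G.map φ).subst σ) V.formalXMulSq_formalMul_two
  simp only [map_mul, map_pow, map_add, map_sub, PowerSeries.map_X, PowerSeries.map_C, map_ofNat,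
    powerSeries_map_subst hD', map_formalXMulSq, map_formalMul, subst_mul hs, subst_pow hs, subst_add hs,
    subst_sub hs, subst_X hs, Literature.NumberTheory.EllipticCurves.C_subst,
    subst_comp_subst_apply hD hs] at h
  have h2 : PowerSeries.subst σ (2 : k⟦X⟧) = 2 := by
    rw [← map_ofNat (C : k →+* k⟦X⟧) 2, Literature.NumberTheory.EllipticCurves.C_subst]
  have h3 : PowerSeries.subst σ (3 : k⟦X⟧) = 3 := by
    rw [← map_ofNat (C : k →+* k⟦X⟧) 3, Literature.NumberTheory.EllipticCurves.C_subst]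
  simp only [h2, h3] at h
  exact h

/-- **`y([2]σ)`, parameter substituted.** [folklore] -/
theorem formalXMulSq_formalMul_twoY_subst {σ : k⟦X⟧} (hσ : constantCoeff σ = 0) :
    (-(V.map φ).formalXMulSq.subst (((V.map φ).formalMul 2).subst σ) +
          C (φ V.a₁) * (V.map φ).formalXMulSq.subst (((V.map φ).formalMul 2).subst σ) *
            ((V.map φ).formalMul 2).subst σ +
          C (φ V.a₃) * ((V.map φ).formalMul 2).subst σ ^ 3) * σ ^ 3 *
        ((C (φ V.a₁) * σ - 2) * (V.map φ).formalXMulSq.subst σ + C (φ V.a₃) * σ ^ 3) =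
      -((3 * (V.map φ).formalXMulSq.subst σ ^ 2 + 2 * C (φ V.a₂) * σ ^ 2 * (V.map φ).formalXMulSq.subst σ +
              C (φ V.a₄) * σ ^ 4 + C (φ V.a₁) * σ * (V.map φ).formalXMulSq.subst σ) *
          ((V.map φ).formalXMulSq.subst (((V.map φ).formalMul 2).subst σ) * σ ^ 2 -
            (V.map φ).formalXMulSq.subst σ * ((V.map φ).formalMul 2).subst σ ^ 2) *
          ((V.map φ).formalMul 2).subst σ) +
        (V.map φ).formalXMulSq.subst σ * ((V.map φ).formalMul 2).subst σ ^ 3 *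
          ((C (φ V.a₁) * σ - 2) * (V.map φ).formalXMulSq.subst σ + C (φ V.a₃) * σ ^ 3) := by
  have hs : PowerSeries.HasSubst σ := PowerSeries.HasSubst.of_constantCoeff_zero' hσ
  have hD : PowerSeries.HasSubst ((V.map φ).formalMul 2) :=
    PowerSeries.HasSubst.of_constantCoeff_zero' ((V.map φ).constantCoeff_formalMul 2)
  have hD' : PowerSeries.HasSubst (V.formalMul 2) :=
    PowerSeries.HasSubst.of_constantCoeff_zero' (V.constantCoeff_formalMul 2)
  have h := congrArg (fun G : ℤ_[p]⟦X⟧ => (G.map φ).subst σ) V.formalXMulSq_formalMul_twoY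
  simp only [map_mul, map_pow, map_add, map_sub, map_neg, PowerSeries.map_X, PowerSeries.map_C, map_ofNat,
    powerSeries_map_subst hD', map_formalXMulSq, map_formalMul, subst_mul hs, subst_pow hs, subst_add hs,
    subst_sub hs, subst_X hs, Literature.NumberTheory.EllipticCurves.C_subst,
    subst_comp_subst_apply hD hs] at h
  have hneg : ∀ G : k⟦X⟧, PowerSeries.subst σ (-G) = -PowerSeries.subst σ G :=
    fun G => by rw [← PowerSeries.coe_substAlgHom hs, map_neg]
  have h2 : PowerSeries.subst σ (2 : k⟦X⟧) = 2 := by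
    rw [← map_ofNat (C : k →+* k⟦X⟧) 2, Literature.NumberTheory.EllipticCurves.C_subst]
  have h3 : PowerSeries.subst σ (3 : k⟦X⟧) = 3 := by
    rw [← map_ofNat (C : k →+* k⟦X⟧) 3, Literature.NumberTheory.EllipticCurves.C_subst]
  simp only [hneg, h2, h3, subst_mul hs, subst_pow hs, subst_add hs, subst_sub hs, subst_X hs,
    Literature.NumberTheory.EllipticCurves.C_subst, subst_comp_subst_apply hD hs] at h
  exact h

end Subst

end WeierstrassCurve

namespace WeierstrassCurve

open scoped LaurentSeries
open PowerSeries Literature.NumberTheory.EllipticCurves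

section LaurentAdd

variable {p : ℕ} [Fact p.Prime] (V : WeierstrassCurve ℤ_[p]) [hE : (V.map PadicInt.Coe.ringHom).IsElliptic]
  {k : Type*} [Field k] (φ : ℤ_[p] →+* k) [hEk : (V.map φ).IsElliptic]

omit hE hEk in
/-- `F(σ, τ)` has no constant term. [folklore] -/
theorem constantCoeff_formalGroupLaw_subst_pair {σ τ : k⟦X⟧} (hσ0 : constantCoeff σ = 0)
    (hτ0 : constantCoeff τ = 0) :
    constantCoeff (MvPowerSeries.subst ![σ, τ] (V.map φ).formalGroupLaw) = 0 :=
  MvPowerSeries.constantCoeff_subst_eq_zero (hasSubst_pair hσ0 hτ0)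
    (fun i => by fin_cases i <;> assumption) (V.map φ).constantCoeff_formalGroupLaw

omit hE hEk in
/-- `X(0) = 1` (substituting the zero series). [folklore] -/
theorem formalXMulSq_subst_zero : (V.map φ).formalXMulSq.subst (0 : k⟦X⟧) = 1 := by
  rw [PowerSeries.subst_zero_eq_C_constantCoeff, (V.map φ).constantCoeff_formalXMulSq]
  simp

/-- **`P(σ) + P(τ) = P(F(σ, τ))` when `x(σ) ≠ x(τ)`** (the chord case): Mathlib's chord
`(addX, addY)` of the two formal points is the formal point of parameter `F(σ, τ)`, by
`formalXMulSq_formalGroupLaw_chord(Y)_subst` divided by `F²σ⁶τ⁶` (resp. `F³σ⁵τ³`).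
[Silverman AEC IV.1 ("`F(z₁, z₂)` … gives the group law"), VII.2.2] [cite: SilvermanAEC2009, IV.1.1] -/
theorem laurentPt_add_of_laurentX_ne {σ τ : k⟦X⟧} (hσ0 : constantCoeff σ = 0) (hτ0 : constantCoeff τ = 0)
    (hσ : σ ≠ 0) (hτ : τ ≠ 0) (hx : (V.map φ).laurentX σ ≠ (V.map φ).laurentX τ) :
    (V.map φ).laurentPt σ hσ0 + (V.map φ).laurentPt τ hτ0 =
      (V.map φ).laurentPt (MvPowerSeries.subst ![σ, τ] (V.map φ).formalGroupLaw)
        (constantCoeff_formalGroupLaw_subst_pair V φ hσ0 hτ0) := by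
  set E := V.map φ with hEdef
  set F : k⟦X⟧ := MvPowerSeries.subst ![σ, τ] E.formalGroupLaw with hFdef
  -- the two identities in `k⸨X⸩`
  have keyX := congrArg (fun f : k⟦X⟧ => (f : k⸨X⸩)) (V.formalXMulSq_formalGroupLaw_chord_subst φ hσ0 hτ0)
  have keyY := congrArg (fun f : k⟦X⟧ => (f : k⸨X⸩)) (V.formalXMulSq_formalGroupLaw_chordY_subst φ hσ0 hτ0)
  simp only [PowerSeries.coe_mul, PowerSeries.coe_pow, PowerSeries.coe_add, PowerSeries.coe_sub,
    PowerSeries.coe_neg] at keyX keyY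
  rw [← hEdef, ← hFdef] at keyX keyY
  have hsc := coe_laurent_ne_zero hσ
  have htc := coe_laurent_ne_zero hτ
  -- `F ≠ 0`
  have hxs : ((E.formalXMulSq.subst σ : k⟦X⟧) : k⸨X⸩) * ((τ : k⟦X⟧) : k⸨X⸩) ^ 2 -
      ((E.formalXMulSq.subst τ : k⟦X⟧) : k⸨X⸩) * ((σ : k⟦X⟧) : k⸨X⸩) ^ 2 ≠ 0 := by
    intro h0
    apply hx
    rw [laurentX, laurentX, div_eq_div_iff (pow_ne_zero 2 hsc) (pow_ne_zero 2 htc)]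
    linear_combination h0
  have hF0 : F ≠ 0 := by
    intro hF
    rw [hF, formalXMulSq_subst_zero, PowerSeries.coe_one, PowerSeries.coe_zero] at keyX
    have : (((E.formalXMulSq.subst σ : k⟦X⟧) : k⸨X⸩) * ((τ : k⟦X⟧) : k⸨X⸩) ^ 2 -
        ((E.formalXMulSq.subst τ : k⟦X⟧) : k⸨X⸩) * ((σ : k⟦X⟧) : k⸨X⸩) ^ 2) ^ 2 *
        ((σ : k⟦X⟧) : k⸨X⸩) ^ 2 * ((τ : k⟦X⟧) : k⸨X⸩) ^ 2 = 0 := by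
      linear_combination keyX
    simp only [mul_eq_zero, pow_eq_zero_iff, ne_eq, OfNat.ofNat_ne_zero, not_false_eq_true] at this
    rcases this with (h | h) | h
    · exact hxs h
    · exact hsc h
    · exact htc h
  have hFc := coe_laurent_ne_zero hF0
  -- the points
  rw [laurentPt_of_ne_zero hσ0 hσ, laurentPt_of_ne_zero hτ0 hτ, laurentPt_of_ne_zero _ hF0,
    Affine.Point.add_of_X_ne hx]
  simp only [Affine.Point.some.injEq]
  have hcX := chart_chordX hsc htc hFc keyX
  have hcY := chart_chordY hsc htc hFc keyY
  have haddX := chord_addX_mul (E.baseChange k⸨X⸩) (E.laurentY σ) (E.laurentY τ) hx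
  have haddY := chord_addY_mul (E.baseChange k⸨X⸩) (E.laurentY σ) (E.laurentY τ) hx
  simp only [baseChange, map_a₁, map_a₂, map_a₃, algebraMap_laurentSeries_eq_coe_C, map_a₁, hEdef] at haddX haddY hcX hcY ⊢
  simp only [laurentX, laurentY] at haddX haddY hx ⊢
  have hD : E.formalXMulSq.subst σ / ((σ : k⟦X⟧) : k⸨X⸩) ^ 2 -
      E.formalXMulSq.subst τ / ((τ : k⟦X⟧) : k⸨X⸩) ^ 2 ≠ (0 : k⸨X⸩) := sub_ne_zero.mpr hx
  have hX3 := mul_right_cancel₀ (pow_ne_zero 2 hD) (haddX.trans hcX.symm)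
  refine ⟨hX3, ?_⟩
  rw [hX3] at haddY
  have hY3 := mul_right_cancel₀ hD (haddY.trans hcY.symm)
  linear_combination hY3

omit hE hEk in
/-- `[2](σ) = F(σ, σ)`. [Silverman AEC IV.2] [folklore] -/
theorem formalMul_two_subst {σ : k⟦X⟧} (hσ0 : constantCoeff σ = 0) :
    ((V.map φ).formalMul 2).subst σ = MvPowerSeries.subst ![σ, σ] (V.map φ).formalGroupLaw := by
  have hs : PowerSeries.HasSubst σ := PowerSeries.HasSubst.of_constantCoeff_zero' hσ0
  rw [(V.map φ).formalMul_two, PowerSeries.subst, MvPowerSeries.subst_comp_subst_apply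
    (hasSubst_pair PowerSeries.constantCoeff_X PowerSeries.constantCoeff_X) hs.const]
  congr 1
  funext i
  fin_cases i <;> simp [← PowerSeries.subst_def, PowerSeries.subst_X hs]

omit hE hEk in
/-- `Ỹ(σ) = (a₁σ − 2)X(σ) + a₃σ³` has constant term `−2`. [folklore] -/
theorem constantCoeff_formalYTilde_subst {σ : k⟦X⟧} (hσ0 : constantCoeff σ = 0) :
    constantCoeff ((C (φ V.a₁) * σ - 2) * (V.map φ).formalXMulSq.subst σ + C (φ V.a₃) * σ ^ 3) = -2 := by
  rw [map_add, map_mul, map_mul, map_sub, map_mul, map_pow, constantCoeff_C, constantCoeff_C, hσ0,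
    constantCoeff_formalXMulSq_subst hσ0, map_ofNat]
  ring

omit hE hEk in
/-- Field algebra: `Ỹ = s³·(y − (−y − a₁x − a₃))` in the chart. [folklore] -/
theorem formalYTilde_chart {K : Type*} [Field K] (A s a₁ a₃ : K) (hs : s ≠ 0) :
    (a₁ * s - 2) * A + a₃ * s ^ 3 = s ^ 3 * (-A / s ^ 3 - (-(-A / s ^ 3) - a₁ * (A / s ^ 2) - a₃)) := by
  field_simp
  ring

/-- **`P(σ) + P(σ) = P([2](σ))`** (the tangent case, characteristic `≠ 2`): `P(σ)` is not a
`2`-torsion point (`2y + a₁x + a₃ = Ỹ(σ)/σ³ ≠ 0`), and Mathlib's tangent `(addX, addY)` is the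
formal point of parameter `[2](σ)`, by `formalXMulSq_formalMul_two(Y)_subst`.
[Silverman AEC III.2.3 (duplication), IV.2, VII.2.2] [cite: SilvermanAEC2009, IV.2] -/
theorem laurentPt_add_self (h2 : (2 : k) ≠ 0) {σ : k⟦X⟧} (hσ0 : constantCoeff σ = 0) (hσ : σ ≠ 0) :
    (V.map φ).laurentPt σ hσ0 + (V.map φ).laurentPt σ hσ0 =
      (V.map φ).laurentPt (((V.map φ).formalMul 2).subst σ)
        (Literature.RingTheory.FormalGroups.constantCoeff_subst_of_constantCoeff_eq_zero hσ0 _ |>.trans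
          ((V.map φ).constantCoeff_formalMul 2)) := by
  set E := V.map φ with hEdef
  set D : k⟦X⟧ := (E.formalMul 2).subst σ with hDdef
  have keyX := congrArg (fun f : k⟦X⟧ => (f : k⸨X⸩)) (V.formalXMulSq_formalMul_two_subst φ hσ0)
  have keyY := congrArg (fun f : k⟦X⟧ => (f : k⸨X⸩)) (V.formalXMulSq_formalMul_twoY_subst φ hσ0)
  simp only [PowerSeries.coe_mul, PowerSeries.coe_pow, PowerSeries.coe_add, PowerSeries.coe_sub,
    PowerSeries.coe_neg] at keyX keyY
  have c2 : ((2 : k⟦X⟧) : k⸨X⸩) = 2 := by rw [← map_ofNat (C : k →+* k⟦X⟧) 2, PowerSeries.coe_C]; rfl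
  have c3 : ((3 : k⟦X⟧) : k⸨X⸩) = 3 := by rw [← map_ofNat (C : k →+* k⟦X⟧) 3, PowerSeries.coe_C]; rfl
  rw [c2, c3] at keyX keyY
  rw [← hEdef, ← hDdef] at keyX keyY
  have hsc := coe_laurent_ne_zero hσ
  -- `Ỹ(σ) ≠ 0`, i.e. `P(σ)` is not `2`-torsion
  set Yt : k⟦X⟧ := (C (φ V.a₁) * σ - 2) * E.formalXMulSq.subst σ + C (φ V.a₃) * σ ^ 3 with hYtdef
  have hYt0 : Yt ≠ 0 := by
    intro h0
    have := V.constantCoeff_formalYTilde_subst φ hσ0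
    rw [← hEdef, ← hYtdef, h0, map_zero] at this
    exact h2 (by linear_combination this)
  have hYtc : ((Yt : k⟦X⟧) : k⸨X⸩) ≠ 0 := coe_laurent_ne_zero hYt0
  have hYte : ((Yt : k⟦X⟧) : k⸨X⸩) = ((σ : k⟦X⟧) : k⸨X⸩) ^ 3 *
      (E.laurentY σ - (E.baseChange k⸨X⸩).toAffine.negY (E.laurentX σ) (E.laurentY σ)) := by
    rw [hYtdef, PowerSeries.coe_add, PowerSeries.coe_mul, PowerSeries.coe_mul, PowerSeries.coe_sub,
      PowerSeries.coe_mul, PowerSeries.coe_pow, c2]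
    simp only [Affine.negY, baseChange, map_a₁, map_a₃, algebraMap_laurentSeries_eq_coe_C, laurentX, laurentY, hEdef]
    exact formalYTilde_chart _ _ _ _ hsc
  have hy : E.laurentY σ ≠ (E.baseChange k⸨X⸩).toAffine.negY (E.laurentX σ) (E.laurentY σ) := by
    intro h
    apply hYtc
    rw [hYte, sub_eq_zero.mpr h, mul_zero]
  -- `D ≠ 0`
  have hD0 : D ≠ 0 := by
    intro hD
    rw [hD, formalXMulSq_subst_zero, PowerSeries.coe_one, PowerSeries.coe_zero] at keyX
    have : ((σ : k⟦X⟧) : k⸨X⸩) ^ 2 * ((Yt : k⟦X⟧) : k⸨X⸩) ^ 2 = 0 := by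
      rw [hYtdef, PowerSeries.coe_add, PowerSeries.coe_mul, PowerSeries.coe_mul, PowerSeries.coe_sub,
        PowerSeries.coe_mul, PowerSeries.coe_pow, c2]
      linear_combination keyX
    simp only [mul_eq_zero, pow_eq_zero_iff, ne_eq, OfNat.ofNat_ne_zero, not_false_eq_true] at this
    rcases this with h | h
    · exact hsc h
    · exact hYtc h
  have hDc := coe_laurent_ne_zero hD0
  -- the points
  rw [laurentPt_of_ne_zero hσ0 hσ, laurentPt_of_ne_zero _ hD0, Affine.Point.add_self_of_Y_ne hy]
  simp only [Affine.Point.some.injEq]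
  have hcX := chart_doubleX hsc hDc keyX
  have hcY := chart_doubleY hsc hDc keyY
  have htanX := tangent_addX_mul (E.baseChange k⸨X⸩) hy
  have htanY := tangent_addY_mul (E.baseChange k⸨X⸩) hy
  simp only [baseChange, map_a₁, map_a₂, map_a₃, map_a₄, algebraMap_laurentSeries_eq_coe_C, hEdef] at htanX htanY hcX hcY hy ⊢
  simp only [laurentX, laurentY, Affine.negY] at htanX htanY hy ⊢
  have hDy : -(((V.map φ).formalXMulSq.subst σ : k⟦X⟧) : k⸨X⸩) / ((σ : k⟦X⟧) : k⸨X⸩) ^ 3 -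
      (-(-(((V.map φ).formalXMulSq.subst σ : k⟦X⟧) : k⸨X⸩) / ((σ : k⟦X⟧) : k⸨X⸩) ^ 3) -
        ((C (φ V.a₁) : k⟦X⟧) : k⸨X⸩) * ((((V.map φ).formalXMulSq.subst σ : k⟦X⟧) : k⸨X⸩) /
          ((σ : k⟦X⟧) : k⸨X⸩) ^ 2) - ((C (φ V.a₃) : k⟦X⟧) : k⸨X⸩)) ≠ 0 := sub_ne_zero.mpr hy
  have hX3 := mul_right_cancel₀ (pow_ne_zero 2 hDy) (htanX.trans hcX.symm)
  refine ⟨hX3, ?_⟩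
  rw [hX3] at htanY
  have hY3 := mul_right_cancel₀ hDy (htanY.trans hcY.symm)
  linear_combination hY3

end LaurentAdd

end WeierstrassCurve

namespace WeierstrassCurve

open scoped LaurentSeries
open PowerSeries Literature.NumberTheory.EllipticCurves

section LaurentGroupLaw

variable {k : Type*} [Field k] {E : WeierstrassCurve k}

/-- Substituting a one-variable series into a two-entry substitution. [folklore] -/
theorem subst_subst_pair {σ : k⟦X⟧} (hσ0 : constantCoeff σ = 0) {g h : k⟦X⟧}
    (hg : constantCoeff g = 0) (hh : constantCoeff h = 0) (G : MvPowerSeries (Fin 2) k) :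
    PowerSeries.subst σ (MvPowerSeries.subst ![g, h] G) =
      MvPowerSeries.subst ![g.subst σ, h.subst σ] G := by
  have hs : PowerSeries.HasSubst σ := PowerSeries.HasSubst.of_constantCoeff_zero' hσ0
  rw [PowerSeries.subst, MvPowerSeries.subst_comp_subst_apply (hasSubst_pair hg hh) hs.const]
  congr 1
  funext i
  fin_cases i <;> rfl

/-- **`F(σ, i(σ)) = 0`** read through `σ` (`formalGroupLaw_subst_X_formalNeg'`). [Silverman AEC IV.2
(d)] [folklore] -/
theorem formalGroupLaw_subst_pair_formalNeg {σ : k⟦X⟧} (hσ0 : constantCoeff σ = 0) :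
    MvPowerSeries.subst ![σ, E.formalNeg.subst σ] E.formalGroupLaw = 0 := by
  have hs : PowerSeries.HasSubst σ := PowerSeries.HasSubst.of_constantCoeff_zero' hσ0
  have h := congrArg (PowerSeries.subst σ) E.formalGroupLaw_subst_X_formalNeg'
  have h0 : PowerSeries.subst σ (0 : k⟦X⟧) = 0 := by rw [← PowerSeries.coe_substAlgHom hs, map_zero]
  rw [subst_subst_pair hσ0 PowerSeries.constantCoeff_X E.constantCoeff_formalNeg, PowerSeries.subst_X hs,
    h0] at h
  exact h

/-- **`F(σ, 0) = σ`** read through `σ` (`formalGroupLaw_subst_X_zero'`). [Silverman AEC IV.2 (e)]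
[folklore] -/
theorem formalGroupLaw_subst_pair_zero_right {σ : k⟦X⟧} (hσ0 : constantCoeff σ = 0) :
    MvPowerSeries.subst ![σ, 0] E.formalGroupLaw = σ := by
  have hs : PowerSeries.HasSubst σ := PowerSeries.HasSubst.of_constantCoeff_zero' hσ0
  have h := congrArg (PowerSeries.subst σ) E.formalGroupLaw_subst_X_zero'
  rw [subst_subst_pair hσ0 PowerSeries.constantCoeff_X (map_zero _), PowerSeries.subst_X hs,
    ← PowerSeries.coe_substAlgHom hs, map_zero] at h
  exact h

/-- `[n+1](σ) = F([n](σ), σ)`. [Silverman AEC IV.2] [folklore] -/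
theorem formalMul_succ_subst (n : ℕ) {σ : k⟦X⟧} (hσ0 : constantCoeff σ = 0) :
    (E.formalMul (n + 1)).subst σ = MvPowerSeries.subst ![(E.formalMul n).subst σ, σ] E.formalGroupLaw := by
  have hs : PowerSeries.HasSubst σ := PowerSeries.HasSubst.of_constantCoeff_zero' hσ0
  rw [E.formalMul_succ, subst_subst_pair hσ0 (E.constantCoeff_formalMul n) PowerSeries.constantCoeff_X,
    PowerSeries.subst_X hs]

variable [E.IsElliptic]

/-- `laurentPt` only depends on the parameter. [folklore] -/
theorem laurentPt_congr {σ τ : k⟦X⟧} (h : σ = τ) (hσ : constantCoeff σ = 0) (hτ : constantCoeff τ = 0) :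
    E.laurentPt σ hσ = E.laurentPt τ hτ := by
  subst h; rfl

end LaurentGroupLaw

section LaurentAddAll

variable {p : ℕ} [Fact p.Prime] (V : WeierstrassCurve ℤ_[p]) [hE : (V.map PadicInt.Coe.ringHom).IsElliptic]
  {k : Type*} [Field k] (φ : ℤ_[p] →+* k) [hEk : (V.map φ).IsElliptic]

/-- **The formal group law computes the group law of the formal points: `P(F(σ, τ)) = P(σ) + P(τ)`**
for all `σ, τ ∈ Xk⟦X⟧` (`char k ≠ 2`) — the analogue over the Laurent-series field `k⸨X⸩` of
Silverman AEC VII.2.2 / the tree's `formalGroupLaw_padicEval` over `ℚ_p`, for the reduction of a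
curve over `ℤ_p` with elliptic generic fibre. Cases: `σ = 0` or `τ = 0` (`F(0, τ) = τ`);
`x(σ) ≠ x(τ)` (chord, `laurentPt_add_of_laurentX_ne`); `x(σ) = x(τ)`, so `P(τ) = ±P(σ)` and hence
`τ = σ` (tangent, `laurentPt_add_self`) or `τ = i(σ)` (`F(σ, i(σ)) = 0`).
[cite: SilvermanAEC2009, Prop. VII.2.2] -/
theorem laurentPt_formalGroupLaw (h2 : (2 : k) ≠ 0) {σ τ : k⟦X⟧} (hσ0 : constantCoeff σ = 0)
    (hτ0 : constantCoeff τ = 0) :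
    (V.map φ).laurentPt (MvPowerSeries.subst ![σ, τ] (V.map φ).formalGroupLaw)
        (constantCoeff_formalGroupLaw_subst_pair V φ hσ0 hτ0) =
      (V.map φ).laurentPt σ hσ0 + (V.map φ).laurentPt τ hτ0 := by
  set E := V.map φ with hEdef
  by_cases hσ : σ = 0
  · subst hσ
    rw [laurentPt_zero, zero_add]
    exact laurentPt_congr (E.formalGroupLaw_subst_zero (PowerSeries.HasSubst.of_constantCoeff_zero' hτ0)) _ _
  by_cases hτ : τ = 0
  · subst hτ
    rw [laurentPt_zero, add_zero]
    exact laurentPt_congr (formalGroupLaw_subst_pair_zero_right hσ0) _ _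
  by_cases hx : E.laurentX σ = E.laurentX τ
  · rcases Affine.Y_eq_of_X_eq (laurent_equation hσ0 hσ) (laurent_equation hτ0 hτ) hx with hy | hy
    · -- `P(τ) = P(σ)`, so `τ = σ`: tangent case
      have hστ : σ = τ := by
        refine laurentPt_injective (E := E) hσ0 hτ0 ?_
        rw [laurentPt_of_ne_zero hσ0 hσ, laurentPt_of_ne_zero hτ0 hτ]
        simp only [Affine.Point.some.injEq]
        exact ⟨hx, hy⟩
      subst hστ
      rw [laurentPt_add_self V φ h2 hσ0 hσ]
      exact laurentPt_congr (V.formalMul_two_subst φ hσ0).symm _ _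
    · -- `P(τ) = -P(σ)`, so `τ = i(σ)`
      have hτi : τ = E.formalNeg.subst σ := by
        refine laurentPt_injective (E := E) hτ0 (constantCoeff_formalNeg_subst hσ0) ?_
        rw [← neg_laurentPt hσ0, laurentPt_of_ne_zero hσ0 hσ, laurentPt_of_ne_zero hτ0 hτ,
          Affine.Point.neg_some]
        simp only [Affine.Point.some.injEq]
        exact ⟨hx.symm, by rw [hy, ← hx, Affine.negY_negY]⟩
      subst hτi
      rw [← neg_laurentPt hσ0, add_neg_cancel]
      rw [laurentPt_congr (formalGroupLaw_subst_pair_formalNeg hσ0) _ (map_zero _), laurentPt_zero]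
  · exact (V.laurentPt_add_of_laurentX_ne φ hσ0 hτ0 hσ hτ hx).symm

/-- **`P([n](σ)) = n • P(σ)`**: the formal multiplication-by-`n` series computes multiplication by
`n` on formal points (Silverman AEC IV.2.3 / VII.2.2; the tree's `padicEval_formalMul_formalParameter`
over `ℚ_p`). [cite: SilvermanAEC2009, Prop. VII.2.2] -/
theorem laurentPt_formalMul (h2 : (2 : k) ≠ 0) (n : ℕ) {σ : k⟦X⟧} (hσ0 : constantCoeff σ = 0) :
    (V.map φ).laurentPt (((V.map φ).formalMul n).subst σ)
        ((Literature.RingTheory.FormalGroups.constantCoeff_subst_of_constantCoeff_eq_zero hσ0 _).trans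
          ((V.map φ).constantCoeff_formalMul n)) =
      n • (V.map φ).laurentPt σ hσ0 := by
  induction n with
  | zero =>
    rw [zero_nsmul]
    have h0 : ((V.map φ).formalMul 0).subst σ = 0 := by
      rw [formalMul_zero, ← PowerSeries.coe_substAlgHom (PowerSeries.HasSubst.of_constantCoeff_zero' hσ0),
        map_zero]
    rw [laurentPt_congr h0 _ (map_zero _), laurentPt_zero]
  | succ n ih =>
    rw [succ_nsmul, ← ih, laurentPt_congr (formalMul_succ_subst n hσ0) _
      (constantCoeff_formalGroupLaw_subst_pair V φ
        ((Literature.RingTheory.FormalGroups.constantCoeff_subst_of_constantCoeff_eq_zero hσ0 _).trans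
          ((V.map φ).constantCoeff_formalMul n)) hσ0), laurentPt_formalGroupLaw V φ h2]

end LaurentAddAll

end WeierstrassCurve
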